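import Literature.NumberTheory.EllipticCurves.ModFiveCongruenceHesseFamily
import Literature.NumberTheory.Automorphic.CDTTheorem712
import Mathlib.RingTheory.Localization.FractionRing
import Mathlib.RingTheory.MvPolynomial.Basic
import Mathlib.RingTheory.Polynomial.Basic
import Mathlib.Algebra.MvPolynomial.CommRing
import Mathlib.Algebra.MvPolynomial.Eval
import HarnessLib

/-!
# stub-ideation k2 · GENERATION 13 — `stub_switch` (= `BCDT.CDT_three_five_switch`), crux `FreyModularity`
# Companion: the GENERIC-POINT SIGN TRICK (Fisher's Lemma 8.4 for `𝔠₆`, hypothesis-free) and the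
# landing shapes.

RESHAPE of k2-g12 §B7 (`kC6_pencil_eq`, which needs `c₆ ≠ 0` to anchor the sign at `s = 0`):
work at the generic point `(a,b,l,m) = (X₀,X₁,X₂,X₃)` of `ℚ(a,b,l,m) = Frac ℚ[X₀..X₃]` (a field of
characteristic `0` in which `D^{Kl}(X₀,X₁) ≠ 0` automatically), get `p² = q²` there from the four
PROVED polynomial inputs (Klein syzygy, L84-C4, L84-D, Hesse syzygy), pull back to the DOMAIN
`ℚ[X₀..X₃]` (`p = ±q`), kill the sign `−` by ONE evaluation at `(1,1,1,0)` (both sides `= c₆^{Kl}(1,1)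
= 20008 ≠ 0`), and specialise by `MvPolynomial.aeval` to every field of characteristic `0`:
`𝔠₆(c₄^{Kl}(v), c₆^{Kl}(v); λ, μ) = c₆^{Kl}(M_v(λ,μ))` with NO hypothesis on `v` — so Fisher 13.2 (i)
(`thm132_geomTorsionFive_of_hesseFamily`) is dischargeable VERBATIM (no `c₆ ≠ 0`), and k3-g11's road
`CDT_three_five_switch_of_thm132` applies UNEDITED.

STATUS: `lean check` (farm) rc 0, **0 sorry**, 0 warnings; `lemma84_C6'` (Lemma 8.4 for `𝔠₆`,
[Fisher2012Hessian, Lemma 8.4, third identity; arXiv:math/0610403 p.12]) is UNCONDITIONAL — §3b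
re-proves the three inputs verbatim from k3-g9/g11 and k2-g12 PART C (≈ 215 s of the ≈ 220 s wall).
-/

set_option linter.dupNamespace false
set_option linter.style.longLine false

namespace Summit.ABC.ABC.Cruxes.FreyModularity.StubSwitchK2g13

open Literature.NumberTheory.EllipticCurves Literature.NumberTheory.EllipticCurves.HesseFamilyFive
open Literature.NumberTheory.Automorphic Literature.NumberTheory.Automorphic.BCDT
open Literature.NumberTheory.GaloisRepresentations
open MvPolynomial

noncomputable section

/-! ## §1 Klein's icosahedral forms and Fisher's integer numerator `N6` (VERBATIM k2-g12 / k3-g11) -/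

section Klein
variable {R S : Type*} [CommRing R] [CommRing S]
variable {Φ : Type*} [FunLike Φ R S] [RingHomClass Φ R S]

/-- Klein's `D`. [folklore] -/
def kD (a b : R) : R := a ^ 11 * b - 11 * a ^ 6 * b ^ 6 - a * b ^ 11
/-- `∂D/∂a`. [folklore] -/
def kDa (a b : R) : R := 11 * a ^ 10 * b - 66 * a ^ 5 * b ^ 6 - b ^ 11
/-- `∂D/∂b`. [folklore] -/
def kDb (a b : R) : R := a ^ 11 - 66 * a ^ 6 * b ^ 5 - 11 * a * b ^ 10
/-- Klein's `c₄`. [folklore] -/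
def kC4 (a b : R) : R :=
  a ^ 20 + 228 * a ^ 15 * b ^ 5 + 494 * a ^ 10 * b ^ 10 - 228 * a ^ 5 * b ^ 15 + b ^ 20
/-- Klein's `c₆`. [folklore] -/
def kC6 (a b : R) : R :=
  -a ^ 30 + 522 * a ^ 25 * b ^ 5 + 10005 * a ^ 20 * b ^ 10 + 10005 * a ^ 10 * b ^ 20
    - 522 * a ^ 5 * b ^ 25 - b ^ 30
/-- Fisher's moving torsor point `M_v(λ,μ)`, first coordinate. [cite: Fisher2012Hessian, Lemma 8.4] -/
def Mv1 (a b l m : R) : R := l * a - m * kDb a b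
/-- second coordinate. [cite: Fisher2012Hessian, Lemma 8.4] -/
def Mv2 (a b l m : R) : R := l * b + m * kDa a b

/-- Klein's syzygy `c₄³ − c₆² = 1728·D⁵`. [folklore] -/
theorem klein_syzygy (a b : R) : kC4 a b ^ 3 - kC6 a b ^ 2 = 1728 * kD a b ^ 5 := by
  simp only [kC4, kC6, kD]; ring

theorem map_kC4 (f : Φ) (a b : R) : f (kC4 a b) = kC4 (f a) (f b) := by
  simp only [kC4, map_add, map_sub, map_mul, map_pow, map_ofNat]
theorem map_kC6 (f : Φ) (a b : R) : f (kC6 a b) = kC6 (f a) (f b) := by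
  simp only [kC6, map_add, map_sub, map_mul, map_pow, map_neg, map_ofNat]
theorem map_kD (f : Φ) (a b : R) : f (kD a b) = kD (f a) (f b) := by
  simp only [kD, map_sub, map_mul, map_pow, map_ofNat]
theorem map_Mv1 (f : Φ) (a b l m : R) : f (Mv1 a b l m) = Mv1 (f a) (f b) (f l) (f m) := by
  simp only [Mv1, kDb, map_sub, map_mul, map_pow, map_ofNat]
theorem map_Mv2 (f : Φ) (a b l m : R) : f (Mv2 a b l m) = Mv2 (f a) (f b) (f l) (f m) := by
  simp only [Mv2, kDa, map_add, map_sub, map_mul, map_pow, map_ofNat]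

/-- VERBATIM k3-g11 Road §Numerators: `𝔠₆ = N6/(17424·240)`. [cite: Fisher2012Hessian, §8] -/
def Pl (c₄ c₆ l m : R) : R :=
  Dlll c₄ c₆ l m * Dmm c₄ c₆ l m + Dll c₄ c₆ l m * Dlmm c₄ c₆ l m
    - 2 * Dlm c₄ c₆ l m * Dllm c₄ c₆ l m
def Pm (c₄ c₆ l m : R) : R :=
  Dllm c₄ c₆ l m * Dmm c₄ c₆ l m + Dll c₄ c₆ l m * Dmmm c₄ c₆ l m
    - 2 * Dlm c₄ c₆ l m * Dlmm c₄ c₆ l m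
def N6 (c₄ c₆ l m : R) : R :=
  Dm c₄ c₆ l m * Pl c₄ c₆ l m - Dl c₄ c₆ l m * Pm c₄ c₆ l m

theorem map_N6 (f : Φ) (c₄ c₆ l m : R) :
    f (N6 c₄ c₆ l m) = N6 (f c₄) (f c₆) (f l) (f m) := by
  simp only [N6, Pl, Pm, Dl, Dm, Dll, Dmm, Dlm, Dlll, Dllm, Dlmm, Dmmm, map_add, map_sub, map_mul,
    map_pow, map_neg, map_ofNat]

set_option maxHeartbeats 4000000 in
/-- Numerator form of `𝔠₆(1,0) = c₆`: a POLYNOMIAL identity over any commutative ring (the new anchor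
lives in `ℤ[c₄,c₆]`, not at a point of `ℚ̄`). [cite: Fisher2012Hessian, §8] -/
theorem N6_one_zero (c₄ c₆ : R) : N6 c₄ c₆ 1 0 = 17424 * 240 * c₆ := by
  simp only [N6, Pl, Pm, Dl, Dm, Dll, Dlm, Dmm, Dlll, Dllm, Dlmm, Dmmm]
  ring

end Klein

theorem C6_eq_N6_div {F : Type*} [Field F] [CharZero F] (c₄ c₆ l m : F) :
    C6 c₄ c₆ l m = N6 c₄ c₆ l m / (17424 * 240) := by
  simp only [C6, C4l, C4m, N6, Pl, Pm]
  field_simp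
  ring

/-! ## §2 The four PROVED polynomial inputs, as generic statements (theorems of k3-g9/g10, k2-g12 PART C) -/

/-- L84-C4 over every char-0 field (k3-g9 `lemma84_C4`, PROVED). -/
def L84C4gen : Prop :=
  ∀ (F : Type) [Field F] [CharZero F] (a b l m : F), kD a b ≠ 0 →
    C4 (kC4 a b) (kC6 a b) l m = kC4 (Mv1 a b l m) (Mv2 a b l m)
/-- L84-D over every commutative ring (k3-g9 `lemma84_D`, PROVED by `ring`). -/
def L84Dgen : Prop :=
  ∀ (F : Type) [Field F] (a b l m : F),
    D (kC4 a b) (kC6 a b) l m * kD a b = kD (Mv1 a b l m) (Mv2 a b l m)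
/-- Hesse's syzygy in both variables over every char-0 field (k2-g12 PART C `hesse_syzygy₂`, PROVED). -/
def HesseSyzygyGen : Prop :=
  ∀ (F : Type) [Field F] [CharZero F] (c₄ c₆ l m : F),
    C4 c₄ c₆ l m ^ 3 - C6 c₄ c₆ l m ^ 2 = (c₄ ^ 3 - c₆ ^ 2) * D c₄ c₆ l m ^ 5

/-! ## §3 The generic point -/

/-- `ℚ[a,b,l,m]`. -/
abbrev A4 : Type := MvPolynomial (Fin 4) ℚ
/-- `ℚ(a,b,l,m)`. -/
abbrev K4 : Type := FractionRing A4

example : IsDomain A4 := inferInstance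
example : Field K4 := inferInstance
instance charZero_K4 : CharZero K4 :=
  charZero_of_injective_algebraMap (IsFractionRing.injective A4 K4)

/-- `p := c₆^{Kl}(M_X(X₂,X₃))`. -/
def P₀ : A4 := kC6 (Mv1 (X 0) (X 1) (X 2) (X 3)) (Mv2 (X 0) (X 1) (X 2) (X 3))
/-- `17424·240·q := N6(c₄^{Kl}(X₀,X₁), c₆^{Kl}(X₀,X₁); X₂, X₃)`. -/
def N₀ : A4 := N6 (kC4 (X 0) (X 1)) (kC6 (X 0) (X 1)) (X 2) (X 3)

/-- `D^{Kl}` does not vanish at the generic point (evaluate at `(1,1)`: `D(1,1) = −11`). -/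
theorem kD_X_ne_zero : kD (X 0 : A4) (X 1) ≠ 0 := by
  intro h
  have e := congrArg (MvPolynomial.eval (![1, 1, 0, 0] : Fin 4 → ℚ)) h
  rw [map_kD, map_zero, eval_X, eval_X] at e
  simp only [kD, Matrix.cons_val_zero, Matrix.cons_val_one] at e
  norm_num at e

/-- **Squares agree at the generic point.**  Same `linear_combination` as k2-g12 `kC6_sq_eq`, run in the
field `ℚ(a,b,l,m)`. -/
theorem sq_eq_generic (h84C4 : L84C4gen) (h84D : L84Dgen) (hHS : HesseSyzygyGen) :
    (algebraMap A4 K4 P₀) ^ 2 * (17424 * 240) ^ 2 = (algebraMap A4 K4 N₀) ^ 2 := by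
  set f := algebraMap A4 K4 with hf
  set a := f (X 0)
  set b := f (X 1)
  set l := f (X 2)
  set m := f (X 3)
  have hD : kD a b ≠ 0 := by
    intro h0
    apply kD_X_ne_zero
    apply IsFractionRing.injective A4 K4
    rw [map_kD, map_zero]; exact h0
  have hP : f P₀ = kC6 (Mv1 a b l m) (Mv2 a b l m) := by
    simp only [P₀, map_kC6, map_Mv1, map_Mv2, a, b, l, m]
  have hN : f N₀ = N6 (kC4 a b) (kC6 a b) l m := by
    simp only [N₀, map_N6, map_kC4, map_kC6, a, b, l, m]
  have E1 := klein_syzygy (Mv1 a b l m) (Mv2 a b l m)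
  have E2 := h84C4 K4 a b l m hD
  have E3 := h84D K4 a b l m
  have E4 := klein_syzygy a b
  have E5 := hHS K4 (kC4 a b) (kC6 a b) l m
  have E6 := C6_eq_N6_div (kC4 a b) (kC6 a b) l m
  have hsq : kC6 (Mv1 a b l m) (Mv2 a b l m) ^ 2 = C6 (kC4 a b) (kC6 a b) l m ^ 2 := by
    rw [← E2, ← E3] at E1
    linear_combination (-1 : K4) * E1 + E5 + D (kC4 a b) (kC6 a b) l m ^ 5 * E4
  rw [hP, hN, hsq, E6]
  field_simp

/-- **The numerator identity in the DOMAIN `ℚ[a,b,l,m]`** — sign killed by evaluation at `(1,1,1,0)`. -/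
theorem numerator_identity (h84C4 : L84C4gen) (h84D : L84Dgen) (hHS : HesseSyzygyGen) :
    (17424 * 240 : A4) * P₀ = N₀ := by
  have inj := IsFractionRing.injective A4 K4
  have hsqA : ((17424 * 240 : A4) * P₀) ^ 2 = N₀ ^ 2 := by
    apply inj
    rw [map_pow, map_pow, map_mul, mul_pow]
    have := sq_eq_generic h84C4 h84D hHS
    rw [← this, map_mul, map_ofNat, map_ofNat]
    ring
  rcases sq_eq_sq_iff_eq_or_eq_neg.mp hsqA with h | h
  · exact h
  · exfalso
    have e := congrArg (MvPolynomial.eval (![1, 1, 1, 0] : Fin 4 → ℚ)) h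
    have v0 : (![1, 1, 1, 0] : Fin 4 → ℚ) 0 = 1 := rfl
    have v1 : (![1, 1, 1, 0] : Fin 4 → ℚ) 1 = 1 := rfl
    have v2 : (![1, 1, 1, 0] : Fin 4 → ℚ) 2 = 1 := rfl
    have v3 : (![1, 1, 1, 0] : Fin 4 → ℚ) 3 = 0 := rfl
    simp only [map_neg, map_mul, map_ofNat, P₀, N₀, map_kC6, map_Mv1, map_Mv2, map_N6, map_kC4,
      eval_X, v0, v1, v2, v3] at e
    rw [N6_one_zero] at e
    simp only [Mv1, Mv2, kC6, kDa, kDb] at e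
    norm_num at e

/-- **Lemma 8.4 for `𝔠₆`, GENERIC (no `c₆ ≠ 0`, no `D^{Kl}(v) ≠ 0`): the target of this reshape.**
[cite: Fisher2012Hessian, Lemma 8.4] -/
theorem lemma84_C6 (h84C4 : L84C4gen) (h84D : L84Dgen) (hHS : HesseSyzygyGen)
    {F : Type*} [Field F] [CharZero F] (a b l m : F) :
    C6 (kC4 a b) (kC6 a b) l m = kC6 (Mv1 a b l m) (Mv2 a b l m) := by
  have h := congrArg (MvPolynomial.aeval (R := ℚ) (![a, b, l, m] : Fin 4 → F))
    (numerator_identity h84C4 h84D hHS)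
  have v0 : (![a, b, l, m] : Fin 4 → F) 0 = a := rfl
  have v1 : (![a, b, l, m] : Fin 4 → F) 1 = b := rfl
  have v2 : (![a, b, l, m] : Fin 4 → F) 2 = l := rfl
  have v3 : (![a, b, l, m] : Fin 4 → F) 3 = m := rfl
  simp only [map_mul, map_ofNat, P₀, N₀, map_kC6, map_Mv1, map_Mv2, map_N6, map_kC4, aeval_X,
    v0, v1, v2, v3] at h
  have hk : (17424 * 240 : F) ≠ 0 := by norm_num
  rw [C6_eq_N6_div, div_eq_iff hk, ← h]
  ring

/-! ## §3b Discharging the three inputs (VERBATIM k3-g9/g11 Road §2 and k2-g12 PART C — crux workfiles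
do not import each other) ⇒ `lemma84_C6'` UNCONDITIONAL -/

section Inputs
variable {F : Type*} [Field F]

/-- second partials of Klein's `D` (k3-g9). [folklore] -/
def kDaa (a b : F) : F := 110 * a ^ 9 * b - 330 * a ^ 4 * b ^ 6
def kDab (a b : F) : F := 11 * a ^ 10 - 396 * a ^ 5 * b ^ 5 - 11 * b ^ 10
def kDbb (a b : F) : F := -330 * a ^ 6 * b ^ 4 - 110 * a * b ^ 9

/-- Euler: `a∂_aD + b∂_bD = 12·D` (k3-g9). [folklore] -/
theorem klein_euler (a b : F) : a * kDa a b + b * kDb a b = 12 * kD a b := by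
  simp only [kDa, kDb, kD]; ring

/-- Klein: `Hess(D) = −121·c₄^{Kl}` (k3-g9). [folklore] -/
theorem klein_hessian (a b : F) : kDaa a b * kDbb a b - kDab a b ^ 2 = -121 * kC4 a b := by
  simp only [kDaa, kDab, kDbb, kC4]; ring

set_option maxHeartbeats 40000000 in
/-- **L84-D** (k3-g9, `ring`). [cite: Fisher2012Hessian, Lemma 8.4] -/
theorem lemma84_D (a b l m : F) :
    D (kC4 a b) (kC6 a b) l m * kD a b = kD (Mv1 a b l m) (Mv2 a b l m) := by
  simp only [D, kC4, kC6, kD, Mv1, Mv2, kDa, kDb]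
  ring

set_option maxHeartbeats 40000000 in
/-- `∂²/∂λ²` of L84-D (k3-g9, verbatim). -/
theorem chain_ll (a b l m : F) :
    Dll (kC4 a b) (kC6 a b) l m * kD a b =
      a ^ 2 * kDaa (Mv1 a b l m) (Mv2 a b l m) + 2 * a * b * kDab (Mv1 a b l m) (Mv2 a b l m)
        + b ^ 2 * kDbb (Mv1 a b l m) (Mv2 a b l m) := by
  simp only [Dll, kC4, kC6, kD, kDaa, kDab, kDbb, Mv1, Mv2, kDa, kDb]; ring

set_option maxHeartbeats 40000000 in
/-- `∂²/∂λ∂μ` of L84-D (k3-g9, verbatim). -/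
theorem chain_lm (a b l m : F) :
    Dlm (kC4 a b) (kC6 a b) l m * kD a b =
      -(a * kDb a b) * kDaa (Mv1 a b l m) (Mv2 a b l m)
        + (a * kDa a b - b * kDb a b) * kDab (Mv1 a b l m) (Mv2 a b l m)
        + b * kDa a b * kDbb (Mv1 a b l m) (Mv2 a b l m) := by
  simp only [Dlm, kC4, kC6, kD, kDaa, kDab, kDbb, Mv1, Mv2, kDa, kDb]; ring

set_option maxHeartbeats 40000000 in
/-- `∂²/∂μ²` of L84-D (k3-g9, verbatim). -/
theorem chain_mm (a b l m : F) :
    Dmm (kC4 a b) (kC6 a b) l m * kD a b =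
      kDb a b ^ 2 * kDaa (Mv1 a b l m) (Mv2 a b l m)
        - 2 * kDa a b * kDb a b * kDab (Mv1 a b l m) (Mv2 a b l m)
        + kDa a b ^ 2 * kDbb (Mv1 a b l m) (Mv2 a b l m) := by
  simp only [Dmm, kC4, kC6, kD, kDaa, kDab, kDbb, Mv1, Mv2, kDa, kDb]; ring

/-- **L84-C4** (k3-g9 via the Hessian chain rule; verbatim). [cite: Fisher2012Hessian, Lemma 8.4] -/
theorem lemma84_C4 [CharZero F] (a b l m : F) (hD : kD a b ≠ 0) :
    C4 (kC4 a b) (kC6 a b) l m = kC4 (Mv1 a b l m) (Mv2 a b l m) := by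
  have hll := chain_ll a b l m
  have hlm := chain_lm a b l m
  have hmm := chain_mm a b l m
  have heul := klein_euler a b
  have hhess := klein_hessian (Mv1 a b l m) (Mv2 a b l m)
  have hk2 : kD a b ^ 2 ≠ 0 := pow_ne_zero _ hD
  have h2 : Dll (kC4 a b) (kC6 a b) l m * Dmm (kC4 a b) (kC6 a b) l m
      - Dlm (kC4 a b) (kC6 a b) l m ^ 2 = -17424 * kC4 (Mv1 a b l m) (Mv2 a b l m) := by
    apply mul_right_cancel₀ hk2
    linear_combination (Dmm (kC4 a b) (kC6 a b) l m * kD a b) * hll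
      + (a ^ 2 * kDaa (Mv1 a b l m) (Mv2 a b l m) + 2 * a * b * kDab (Mv1 a b l m) (Mv2 a b l m)
          + b ^ 2 * kDbb (Mv1 a b l m) (Mv2 a b l m)) * hmm
      - (Dlm (kC4 a b) (kC6 a b) l m * kD a b
          + (-(a * kDb a b) * kDaa (Mv1 a b l m) (Mv2 a b l m)
            + (a * kDa a b - b * kDb a b) * kDab (Mv1 a b l m) (Mv2 a b l m)
            + b * kDa a b * kDbb (Mv1 a b l m) (Mv2 a b l m))) * hlm
      + ((kDaa (Mv1 a b l m) (Mv2 a b l m) * kDbb (Mv1 a b l m) (Mv2 a b l m)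
          - kDab (Mv1 a b l m) (Mv2 a b l m) ^ 2) * (a * kDa a b + b * kDb a b + 12 * kD a b)) * heul
      + (144 * kD a b ^ 2) * hhess
  rw [C4, h2]
  field_simp

set_option maxHeartbeats 64000000 in
/-- **Hesse's syzygy (8.1), direct family, `n = 5`, both variables** (k2-g12 PART C, verbatim, ≈ 125 s).
[cite: Fisher2012Hessian, (8.1)] -/
theorem hesse_syzygy₂ [CharZero F] (c₄ c₆ l m : F) :
    C4 c₄ c₆ l m ^ 3 - C6 c₄ c₆ l m ^ 2 = (c₄ ^ 3 - c₆ ^ 2) * D c₄ c₆ l m ^ 5 := by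
  simp only [C4, C6, C4l, C4m, D, Dl, Dm, Dll, Dlm, Dmm, Dlll, Dllm, Dlmm, Dmmm]
  field_simp
  ring

end Inputs

theorem L84C4gen_holds : L84C4gen := fun _ _ _ a b l m hD => lemma84_C4 a b l m hD
theorem L84Dgen_holds : L84Dgen := fun _ _ a b l m => lemma84_D a b l m
theorem HesseSyzygyGen_holds : HesseSyzygyGen := fun _ _ _ c₄ c₆ l m => hesse_syzygy₂ c₄ c₆ l m

/-- **Lemma 8.4 for `𝔠₆` — UNCONDITIONAL, kernel-checked:** for every field of characteristic `0` and ALL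
`a b l m`, `𝔠₆(c₄^{Kl}(a,b), c₆^{Kl}(a,b); l, m) = c₆^{Kl}(M_{(a,b)}(l,m))`.  [cite: Fisher2012Hessian, Lemma 8.4] -/
theorem lemma84_C6' {F : Type*} [Field F] [CharZero F] (a b l m : F) :
    C6 (kC4 a b) (kC6 a b) l m = kC6 (Mv1 a b l m) (Mv2 a b l m) :=
  lemma84_C6 L84C4gen_holds L84Dgen_holds HesseSyzygyGen_holds a b l m

/-! ## §4 Landing shapes (statement sanity only) -/

/-- M5 export (shape). -/
def ShapeF1 : Prop := thm132_geomTorsionFive_of_hesseFamily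
/-- M6 export (shape). -/
def ShapeSwitch : Prop := CDT_three_five_switch

/-- M7: the Theorems closer is ONE term — the registered stub signature is `CDT_three_five_switch` by `δ`. -/
theorem stub_switch_of_holds (h : CDT_three_five_switch) :
    ∀ (W : WeierstrassCurve ℚ) [W.IsElliptic], ¬ 27 ∣ W.conductorNorm ℤ →
      (∀ ρ₃ : ModPGaloisRep ℚ (ZMod 3) 2, W.IsTorsionGaloisRep 3 ρ₃ →
        ¬ ρ₃.IsAbsIrreducibleOverSqrt (-3)) →
      ∀ (ρ : ModPGaloisRep ℚ (ZMod 5) 2), W.IsTorsionGaloisRep 5 ρ → ρ.IsAbsIrreducibleOverSqrt 5 →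
      ∃ (W' : WeierstrassCurve ℚ) (_ : W'.IsElliptic), W'.IsTorsionGaloisRep 5 ρ ∧
        ∃ ρ₃' : ModPGaloisRep ℚ (ZMod 3) 2, W'.IsTorsionGaloisRep 3 ρ₃' ∧
          ρ₃'.IsAbsIrreducibleOverSqrt (-3) :=
  h

end

end Summit.ABC.ABC.Cruxes.FreyModularity.StubSwitchK2g13
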